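import Mathlib
import HarnessLib
import Summits.CriticalPhenomena.CardyFormulaZ2.Theses.CardySelfRefinement
import Literature.Probability.RandomPlanarGeometry.ChordalReversibility
import Literature.Probability.RandomPlanarGeometry.ConformalRectangle
import Literature.Probability.RandomPlanarGeometry.IsometryCovariance
import Literature.Probability.Percolation.IkhlefPonsaingFirstPassage
import Summits.CriticalPhenomena.CardyFormulaZ2.Theorems.CardyBoundaryCoulombGasHalfPlaneOneArmThirdIpRecursionOfFact
import Summits.CriticalPhenomena.CardyFormulaZ2.Theorems.CardyBoundaryCoulombGasHalfPlaneOneArmThirdPassageLeArm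
import Summits.CriticalPhenomena.CardyFormulaZ2.Theorems.CardyBoundaryCoulombGasHalfPlaneOneArmThirdArmLePassage
import Summits.CriticalPhenomena.CardyFormulaZ2.Theorems.CardySelfRefinementSymmetryUpgradeRTouchRecursionTwoSided

/-!
# Two-sided `n^{-1/3}` bounds for the diagonal half-plane one-arm probability of bond-`ℤ²`
# (conditional on Ikhlef–Ponsaing, Prop. 4.7)

Helper file for stub `stub_touchExponent` (S3) of line `SketchIdeatorTwo` of crux `SymmetryUpgradeR`
(stmt-CriticalPhenomena-17239, route CardySelfRefinement), stage T2.

In diagonal coordinates `s = v₀ + v₁`, `d = v₀ - v₁`, let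
`π◇(n) = P_{1/2}[0 ↔ {s = -n} ∪ {d = n} ∪ {d = -n} inside {s ≤ 1, -n ≤ s, |d| ≤ n}]` be the
diagonal half-plane one-arm probability of bond percolation on `ℤ²` at `p = 1/2` (the event of
`diagArm_exponent_of_ikhlefPonsaing`, `Theorems/CardyBoundaryCoulombGasHalfPlaneOneArmThird.lean`).
CONDITIONAL on the tree's named fact `Literature.Probability.Percolation.IkhlefPonsaingFirstPassage`
(Ikhlef–Ponsaing, J. Stat. Phys. 149 (2012) 10–36, arXiv:1202.5476, Prop. 4.7: the exact
wall-passage probability `P_b(2m+1)` of the diagonal wired/free strip; an unproved hypothesis here,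
entering only as the antecedent), `π◇(n)` obeys the power law of exponent `-1/3` UP TO CONSTANTS:

`c · n^{-1/3} ≤ π◇(n) ≤ C · n^{-1/3}` for all `n ≥ 1`, with `0 < c`.

This is the up-to-constants sharpening of the log-form `diagArm_exponent_of_ikhlefPonsaing`
(`log π◇(n) / log n → -1/3`), assembled from the same landed pieces of line `ip-passage-stirling`
(crux `HalfPlaneOneArmThird`): the bridge fact ⇒ recursion
`P_b(2m+3)(3m+4)(4m+7)(6m+5) = P_b(2m+1)(3m+5)(4m+3)(6m+7)` (`stub_ipRecursion_of_ikhlefPonsaing`),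
the two-sided power bounds for that recursion (`touchExponent_recursionTwoSided`, T1 of this stub),
and the matched-scale sandwich `c₀ π◇(n) ≤ P_b(2n+1) ≤ π◇(n)` (`stub_armLePassage`,
`stub_passageLeArm`).
-/

noncomputable section

namespace Summit.CriticalPhenomena.CardyFormulaZ2.Theorems.SymmetryUpgradeR.SwallowingSkeleton

open MeasureTheory Filter Set
open Literature.Probability.RandomPlanarGeometry Literature.Probability.LatticeModels
  Literature.Probability.Percolation
open UpperHalfPlane (upperHalfPlaneSet)
open Summit.CriticalPhenomena.CardyFormulaZ2.Cruxes.HalfPlaneOneArmThird.IpPassageStirling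

/-- **T2 `touchExponent_diagArmTwoSided`** (registered helper for `stub_touchExponent`).
Conditional on Ikhlef–Ponsaing's Prop. 4.7 (`IkhlefPonsaingFirstPassage`), the DIAGONAL half-plane
one-arm probability of bond-`ℤ²` at `p = 1/2` satisfies `c n^{-1/3} ≤ π◇(n) ≤ C n^{-1/3}` for
every `n ≥ 1`, for some constants `0 < c`, `C`. -/
theorem touchExponent_diagArmTwoSided : Literature.Probability.Percolation.IkhlefPonsaingFirstPassage → ∃ c C : ℝ, 0 < c ∧ ∀ n : ℕ, 1 ≤ n → c * (n : ℝ) ^ (-(1 / 3 : ℝ)) ≤ (bondPercolation (zdGraph 2) half).real {ω | ∃ y : Site 2, (y 0 + y 1 = -(n : ℤ) ∨ y 0 - y 1 = (n : ℤ) ∨ y 0 - y 1 = -(n : ℤ)) ∧ ω ∈ openConnIn {v : Site 2 | v 0 + v 1 ≤ 1 ∧ -(n : ℤ) ≤ v 0 + v 1 ∧ -(n : ℤ) ≤ v 0 - v 1 ∧ v 0 - v 1 ≤ n} 0 y} ∧ (bondPercolation (zdGraph 2) half).real {ω | ∃ y : Site 2, (y 0 + y 1 = -(n : ℤ) ∨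 y 0 - y 1 = (n : ℤ) ∨ y 0 - y 1 = -(n : ℤ)) ∧ ω ∈ openConnIn {v : Site 2 | v 0 + v 1 ≤ 1 ∧ -(n : ℤ) ≤ v 0 + v 1 ∧ -(n : ℤ) ≤ v 0 - v 1 ∧ v 0 - v 1 ≤ n} 0 y} ≤ C * (n : ℝ) ^ (-(1 / 3 : ℝ)) := by
  intro hIP
  -- the wall-passage probability `P_b(2m+1)` and the diagonal arm probability `π◇(n)`, inline
  let W : ℕ → ℝ := fun m ↦ (bondPercolation (zdGraph 2) half).real
    {ω | ∃ y : Site 2, y 0 + y 1 = 0 ∧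
      ω ∈ openConnIn {v : Site 2 | 0 ≤ v 0 + v 1 ∧ v 0 + v 1 ≤ 2 * (m : ℤ) + 1} ![2 * (m : ℤ), 0] y}
  let D : ℕ → ℝ := fun n ↦ (bondPercolation (zdGraph 2) half).real
    {ω | ∃ y : Site 2, (y 0 + y 1 = -(n : ℤ) ∨ y 0 - y 1 = (n : ℤ) ∨ y 0 - y 1 = -(n : ℤ)) ∧
      ω ∈ openConnIn {v : Site 2 | v 0 + v 1 ≤ 1 ∧ -(n : ℤ) ≤ v 0 + v 1 ∧
        -(n : ℤ) ≤ v 0 - v 1 ∧ v 0 - v 1 ≤ n} 0 y}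
  -- the fact gives the recursion
  have hrec : ∀ m : ℕ, W (m + 1) * ((3 * (m : ℝ) + 4) * (4 * (m : ℝ) + 7) * (6 * (m : ℝ) + 5)) =
      W m * ((3 * (m : ℝ) + 5) * (4 * (m : ℝ) + 3) * (6 * (m : ℝ) + 7)) :=
    fun m ↦ stub_ipRecursion_of_ikhlefPonsaing hIP m
  -- `P_b(1) = 1`: the site `(0,0)` lies on the wired row
  have hW0 : W 0 = 1 := by
    have hmem : (![2 * ((0 : ℕ) : ℤ), 0] : Site 2) ∈
        {v : Site 2 | 0 ≤ v 0 + v 1 ∧ v 0 + v 1 ≤ 2 * ((0 : ℕ) : ℤ) + 1} := by simp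
    show (bondPercolation (zdGraph 2) half).real _ = 1
    convert MeasureTheory.probReal_univ (μ := bondPercolation (zdGraph 2) half) using 2
    refine Set.eq_univ_of_forall fun ω => ⟨![2 * ((0 : ℕ) : ℤ), 0], by simp, ?_⟩
    exact ⟨hmem, hmem, SimpleGraph.Reachable.refl _⟩
  -- T1: two-sided power bounds for `P_b`
  obtain ⟨c₁, C₁, hc₁, hT1⟩ := touchExponent_recursionTwoSided W hW0 hrec
  -- the sandwich
  have h₃ : ∀ n : ℕ, 1 ≤ n → W n ≤ D n := fun n hn ↦ stub_passageLeArm n hn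
  obtain ⟨c₂, hc₂, h₄⟩ := stub_armLePassage
  refine ⟨c₁, C₁ / c₂, hc₁, fun n hn => ⟨(hT1 n hn).1.trans (h₃ n hn), ?_⟩⟩
  have hle : c₂ * D n ≤ W n := h₄ n hn
  have hup : W n ≤ C₁ * (n : ℝ) ^ (-(1 / 3 : ℝ)) := (hT1 n hn).2
  calc D n = c₂ * D n / c₂ := by field_simp
    _ ≤ C₁ * (n : ℝ) ^ (-(1 / 3 : ℝ)) / c₂ := div_le_div_of_nonneg_right (hle.trans hup) hc₂.le
    _ = C₁ / c₂ * (n : ℝ) ^ (-(1 / 3 : ℝ)) := by ring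

end Summit.CriticalPhenomena.CardyFormulaZ2.Theorems.SymmetryUpgradeR.SwallowingSkeleton

end
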